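import Literature.NumberTheory.Automorphic.Liu2021.AlbaneseBaseChangeJointlyEpi
import Literature.NumberTheory.Automorphic.Liu2021.Lemma24BettiAlbanese
import Literature.AlgebraicGeometry.Motives.BettiCofanAdditivity
import Literature.AlgebraicGeometry.Motives.AlbaneseRationalCohomology
import Literature.AlgebraicGeometry.HodgeTheory.AbelianVarietyBettiOneSplitting
import Literature.AlgebraicGeometry.HodgeTheory.BettiUniverseIsoTransport
import Literature.NumberTheory.Automorphic.Liu2021.Lemma24Helpers
import Literature.NumberTheory.Automorphic.Liu2021.AlbaneseBaseChangeComplexSplit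
import Literature.AlgebraicGeometry.Motives.AlbaneseDimensionBaseChange
import HarnessLib

/-!
# Liu 2021 Lemma 2.4 (1) from an α-compatible Albanese fan over a finite Galois level (III-0, piece F6)

[Liu2021] = Yifeng Liu, *Fourier–Jacobi cycles and arithmetic relative trace formula*, Camb. J. Math. **9** (2021) =
arXiv:2102.11518.  Cell `hodgecm-mathlib` (D-0151), row III-0 (`Liu2021.albanese_bettiOne_pullback_bijective` = Lemma 2.4 (1):
«`(α_X)_x^* : H¹_{B,τ}(Alb_X, ℚ) ≃ H¹_{B,τ}(X, ℚ)`»), the (G)-road (A-p18 lead, carve `CARVE-G-road.md` §F6).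

THE CORE THEOREM `albanese_bettiOne_pullback_bijective_of_fan` takes, for `X / k` (`k ⊆ ℂ` of characteristic zero) and a Liu
Albanese datum `a` (Def. 2.3), the α-COMPATIBLE ALBANESE FAN READ OVER `ℂ` as EXPLICIT DATA — a finite level `L ⊆ ℂ`
together with an ABSTRACT identification `eX : (X ⊗_k L) ⊗_L ℂ ≅ X ⊗_k ℂ` (kept opaque: instantiating it at the
pullback-explicit `Motives.baseChangeHomObjIsoOfComp` inside a proof is kernel-expensive), a finite colimit cofan `e_c : E_c ⟶ X ⊗_k L` of pointed smooth projective pieces with Albanese data `𝒥_c`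
(Milne's difference-map form), homomorphisms `πℂ_c : Alb_X ⊗_k ℂ ⟶ J(E_c) ⊗_L ℂ`, `ιℂ_c : J(E_c) ⊗_L ℂ ⟶ Alb_X ⊗_k ℂ` SPLITTING
`Alb_X ⊗_k ℂ` (`ιℂ ≫ πℂ = δ`, `Σ πℂ ≫ ιℂ = 1`), and lifts `lℂ_c : (E_c ⊗ ℂ) × (E_c ⊗ ℂ) ⟶ (∇X)_ℂ` of `f_c × f_c`
(`f_c := (e_c)_ℂ ≫ eX : E_c ⊗ ℂ ⟶ X ⊗ ℂ`) with `lℂ_c ≫ (α_X)_ℂ = μ ≫ ([x − y]_c)_ℂ ≫ ιℂ_c` — the (G)-road's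
`Albanese.exists_isGalois_split_baseChange_complex_compat_abstract` (A-p10's `G4ℂ`, the fan transported along `L → ℂ`,
with `eX` exported abstractly) — together with the per-piece
inequality (R-bc) `dim J(E_c ⊗_L ℂ) ≤ dim J(E_c)` (A-p14's `Jacobian.dim_le_dim_of_baseChange_complex`), and the CONSUMER's data of
Lemma 2.4 (1) verbatim (cofan `inj_q : Y_q ⟶ X ⊗_k ℂ` of smooth projective geometrically irreducible complex pieces with (R-ℂ)
`b₁(Y_q) ≤ 2 dim J(Y_q)` — the cone's compact ball quotients —, points `x_q`, lifts `ℓ_q`, and `αx` with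
`inj_q ≫ αx = (𝟙, x_q) ≫ ℓ_q ≫ (α_X)_ℂ`), and proves `Function.Bijective (αx^*)` on `H¹(−(ℂ); ℚ)`.

PROOF (block-diagonal, `HodgeTheory.bijective_pull_of_split_factorisation`): the pieces `f_c` are, over `X ⊗ ℂ`, the consumer's
pieces `Y_{q(c)}` with `c ↦ q(c)` a bijection (connected open-closed images; `Morphisms.exists_overIso_comp_eq_of_isColimit_cofan`), so
`(f_c^*)_c` is jointly bijective (`BettiCofan.bijective_pi_pull`) and (R-ℂ) transports to `E_c ⊗ ℂ`; the maps
`g_c := f'^{x′_c} ≫ u_c : E_c ⊗ ℂ → J(E_c) ⊗ ℂ` (complex Abel–Jacobi map of `E_c ⊗ ℂ` at the consumer's point, then the comparison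
`u_c : J(E_c ⊗ ℂ) → J(E_c) ⊗ ℂ`, `Jacobian.exists_hom_baseChange_surjective`) pull back bijectively (the Albanese criterion
`Jacobian.isIso_bettiCohomology_map_abelJacobi_of_finrank_le_of_dim`; `u_c` is an isogeny by (R-bc) + surjectivity,
`ComplexMultiplication.isogeny_bettiMap_bijective_holds`); and `f_c ≫ αx = g_c ≫ ιℂ_c`, because `ℓ_{q(c)} ∘ (φ_c × φ_c)` and `lℂ_c`
both lift `f_c × f_c` through the MONOMORPHISM `(∇X ↪ X × X)_ℂ`.

Theorems only; no definition, no named fact.  HC_CM is proved only modulo the 7 printed citations until rung 0 closes; this file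
makes Lemma 2.4 (1) a THEOREM of (G) + (R-bc) + (R-ℂ) at projective `X`, nothing more.

## References
* [Liu2021] Y. Liu, arXiv:2102.11518 = Camb. J. Math. 9 (2021): Lemma 2.4 (1) (l. 1210–1213) with proof (l. 1220–1228); Def. 2.1,
  Def. 2.3 (l. 1171–1208).
* [Grothendieck1962FGA6] A. Grothendieck, FGA VI (Sém. Bourbaki 236), Thm. 3.3 (iii) (Albanese and base change).
* [MumfordAV1970] D. Mumford, *Abelian Varieties* (1970), §1 (3), §19.
* [Milne1986JacobianVarieties] J. S. Milne, *Jacobian varieties* (1986), §6 Prop. 6.1, 6.4.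
-/

noncomputable section

open CategoryTheory CategoryTheory.Limits AlgebraicGeometry MonoidalCategory CartesianMonoidalCategory
open Literature.AlgebraicGeometry.Motives Literature.AlgebraicGeometry.HodgeTheory

namespace Literature.NumberTheory.Automorphic.Liu2021.AppendixC

open AbelianVariety (bcSpec bcFunctor)

set_option backward.isDefEq.respectTransparency false

/-- `e.hom^*` is bijective on `Hᵏ(−(ℂ); ℚ)` for an isomorphism `e` of complex schemes. [cite: MumfordAV1970, §1 (1)] -/
private theorem pull_hom_bijective {Z Z' : SchemeOver ℂ} (e : Z ≅ Z') (k : ℕ) :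
    Function.Bijective (BettiUniverse.pull e.hom k) :=
  (BettiUniverse.pullEquiv e k).symm.bijective

/-! ## §1 Matching the pieces `E_c ⊗_L ℂ` with the consumer's pieces `Y_q` -/

/-- **Piece matching.**  For a finite colimit cofan `e_c : E_c ⟶ X ⊗_k L` of smooth projective pieces and a colimit cofan
`inj_q : Y_q ⟶ X ⊗_k ℂ` of geometrically irreducible complex pieces, every `E_c ⊗_L ℂ` IS, over `X ⊗_k ℂ` (through any identification
`eX : (X ⊗_k L) ⊗_L ℂ ≅ X ⊗_k ℂ`), one of the `Y_q`, and `c ↦ q(c)` is a BIJECTION (connected open-closed images partition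
`X ⊗ ℂ` on both sides; `Morphisms.exists_overIso_comp_eq_of_isColimit_cofan`).  The pattern of `AlbaneseBaseChangeJointlyEpi` §E–§F.
[cite: GortzWedhorn2020, §(3.5) Example 3.11 and Prop. 4.16] -/
theorem exists_bijective_iso_pieces {k : Type} [Field k] [Algebra k ℂ] {d : ℕ} (X : SchemeOver k)
    {L : Type} [Field L] [Algebra k L] [Algebra L ℂ] (eX : (bcFunctor L ℂ).obj ((bcFunctor k L).obj X) ≅ (bcFunctor k ℂ).obj X)
    {C : Type} [Fintype C] (E : C → SchemeOver L) (e : ∀ c, E c ⟶ (bcFunctor k L).obj X)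
    (hE : ∀ c, IsSmoothProjective d (E c)) (hcolL : IsColimit (Cofan.mk ((bcFunctor k L).obj X) e))
    {Ξ : Type} (Y : Ξ → SchemeOver ℂ) [∀ q, GeometricallyIrreducible (Y q).hom]
    (inj : ∀ q, Y q ⟶ (bcFunctor k ℂ).obj X) (hcol : IsColimit (Cofan.mk ((bcFunctor k ℂ).obj X) inj)) :
    ∃ (q : C → Ξ) (φ : ∀ c, (bcFunctor L ℂ).obj (E c) ≅ Y (q c)), Function.Bijective q ∧
      ∀ c, (φ c).hom ≫ inj (q c) = (bcFunctor L ℂ).map (e c) ≫ eX.hom := by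
  classical
  let FkL := bcFunctor k L
  let FLC := bcFunctor L ℂ
  let FkC := bcFunctor k ℂ
  let f : ∀ c, FLC.obj (E c) ⟶ FkC.obj X := fun c => FLC.map (e c) ≫ eX.hom
  haveI hoe : ∀ c, IsOpenImmersion (e c).left := fun c => isOpenImmersion_left_of_isColimit hcolL c
  haveI hof : ∀ c, IsOpenImmersion (f c).left := fun c => by
    haveI := GaloisDescent.isOpenImmersion_bcFunctor_map_left ℂ (e c)
    change IsOpenImmersion ((FLC.map (e c)).left ≫ eX.hom.left)
    infer_instance
  have hrange : ∀ c, Set.range ⇑(f c).left =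
      ⇑eX.inv.left ⁻¹' (⇑(pullback.fst (FkL.obj X).hom (bcSpec L ℂ)) ⁻¹' Set.range ⇑(e c).left) := fun c => by
    rw [← GaloisDescent.range_bcFunctor_map_left]
    exact range_comp_left_eq_preimage (FLC.map (e c)) eX
  have hfclopen : ∀ c, IsClopen (Set.range ⇑(f c).left) := fun c => by
    rw [hrange c]
    exact ((isClopen_range_left_of_isColimit hcolL c).preimage (Scheme.Hom.continuous _)).preimage
      (Scheme.Hom.continuous _)
  haveI hEgi : ∀ c, GeometricallyIrreducible (FLC.obj (E c)).hom := fun c => ((hE c).baseChange_obj ℂ).geometricallyIrreducible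
  haveI hEconn : ∀ c, ConnectedSpace ↥(FLC.obj (E c)).left := fun c =>
    haveI : IrreducibleSpace ↥(FLC.obj (E c)).left :=
      GeometricallyIrreducible.irreducibleSpace_of_subsingleton (FLC.obj (E c)).hom
    inferInstance
  have hfcov : ∀ z : ↥(FkC.obj X).left, ∃ c, z ∈ Set.range ⇑(f c).left := fun z => by
    obtain ⟨c, y, hy⟩ := exists_eq_left_of_isColimit hcolL (pullback.fst (FkL.obj X).hom (bcSpec L ℂ) (eX.inv.left z))
    exact ⟨c, by rw [hrange c]; exact ⟨y, hy⟩⟩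
  have hfdisj : ∀ {c c' : C}, c ≠ c' → Disjoint (Set.range ⇑(f c).left) (Set.range ⇑(f c').left) :=
    fun {c c'} h => by
      rw [hrange c, hrange c']
      exact ((disjoint_range_left_of_isColimit hcolL h).preimage _).preimage _
  haveI : ∀ q, PreconnectedSpace ↥(Y q).left := fun q =>
    haveI := GeometricallyIrreducible.irreducibleSpace_of_subsingleton (Y q).hom
    inferInstance
  have hmatch : ∀ c, ∃ (q : Ξ) (φ : FLC.obj (E c) ≅ Y q), φ.hom ≫ inj q = f c := fun c =>
    Literature.AlgebraicGeometry.Morphisms.exists_overIso_comp_eq_of_isColimit_cofan hcol (f c) (hfclopen c).1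
  choose q φ hφ using hmatch
  have hrq : ∀ c, Set.range ⇑(inj (q c)).left = Set.range ⇑(f c).left := fun c => by
    rw [← hφ c, Over.comp_left]
    ext z
    constructor
    · rintro ⟨y, rfl⟩
      refine ⟨(φ c).inv.left y, ?_⟩
      rw [Scheme.Hom.comp_apply, ← Scheme.Hom.comp_apply _ _ y, ← Over.comp_left, Iso.inv_hom_id, Over.id_left]
      rfl
    · rintro ⟨y, rfl⟩
      exact ⟨(φ c).hom.left y, by rw [Scheme.Hom.comp_apply]⟩
  have hYne : ∀ q₀, (Set.range ⇑(inj q₀).left).Nonempty := fun q₀ => by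
    haveI := GeometricallyIrreducible.irreducibleSpace_of_subsingleton (Y q₀).hom
    exact Set.range_nonempty _
  have hq_inj : Function.Injective q := by
    intro c c' hcc
    by_contra hne
    have hd := hfdisj hne
    rw [← hrq c, ← hrq c', hcc, Set.disjoint_iff_inter_eq_empty, Set.inter_self] at hd
    exact (hYne (q c')).ne_empty hd
  have hq_surj : Function.Surjective q := by
    intro q₀
    obtain ⟨z, hz⟩ := hYne q₀
    obtain ⟨c, hc⟩ := hfcov z
    refine ⟨c, ?_⟩
    by_contra hne
    have hd := disjoint_range_left_of_isColimit hcol hne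
    rw [hrq c] at hd
    exact Set.disjoint_iff.mp hd ⟨hc, hz⟩
  exact ⟨q, φ, ⟨hq_inj, hq_surj⟩, hφ⟩

/-- **Joint bijectivity of the piece pull-backs**: with the matching of `exists_bijective_iso_pieces`, `ξ ↦ (f_c^* ξ)_c` is bijective on
`H¹` — `H¹(X ⊗ ℂ) ≅ Π_q H¹(Y_q)` (`BettiCofan.bijective_pi_pull`), reindexed along the bijection `c ↦ q(c)` and transported along the
isomorphisms `E_c ⊗ ℂ ≅ Y_{q(c)}`. [cite: HatcherAT2002, §3.1 p. 202] -/
theorem bijective_pi_pull_pieces {C Ξ : Type} {X' : SchemeOver ℂ} {Z : C → SchemeOver ℂ} {Y : Ξ → SchemeOver ℂ}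
    (inj : ∀ q, Y q ⟶ X') (hcol : IsColimit (Cofan.mk X' inj)) (q : C → Ξ) (hq : Function.Bijective q)
    (φ : ∀ c, Z c ≅ Y (q c)) (f : ∀ c, Z c ⟶ X') (hφ : ∀ c, (φ c).hom ≫ inj (q c) = f c) :
    Function.Bijective (fun ξ : bettiCohomology X' 1 => fun c => BettiUniverse.pull (f c) 1 ξ) := by
  classical
  let σ : C ≃ Ξ := Equiv.ofBijective q hq
  have hΘ : Function.Bijective (fun ξ : bettiCohomology X' 1 => fun q₀ => BettiUniverse.pull (inj q₀) 1 ξ) :=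
    BettiCofan.bijective_pi_pull hcol 1
  let R₁ : (∀ q₀, bettiCohomology (Y q₀) 1) ≃ (∀ c, bettiCohomology (Y (q c)) 1) :=
    (Equiv.piCongrLeft (fun q₀ => bettiCohomology (Y q₀) 1) σ).symm
  have hR₂ : Function.Bijective (fun η : (∀ c, bettiCohomology (Y (q c)) 1) => fun c => BettiUniverse.pull (φ c).hom 1 (η c)) :=
    ⟨fun η η' h => funext fun c => (pull_hom_bijective (φ c) 1).1 (congr_fun h c),
      fun θ => ⟨fun c => Function.surjInv (pull_hom_bijective (φ c) 1).2 (θ c),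
        funext fun c => Function.surjInv_eq (pull_hom_bijective (φ c) 1).2 (θ c)⟩⟩
  have heq : (fun ξ : bettiCohomology X' 1 => fun c => BettiUniverse.pull (f c) 1 ξ) =
      (fun η : (∀ c, bettiCohomology (Y (q c)) 1) => fun c => BettiUniverse.pull (φ c).hom 1 (η c)) ∘ R₁ ∘
        (fun ξ : bettiCohomology X' 1 => fun q₀ => BettiUniverse.pull (inj q₀) 1 ξ) := by
    funext ξ c
    change BettiUniverse.pull (f c) 1 ξ = BettiUniverse.pull (φ c).hom 1
      (((Equiv.piCongrLeft (fun q₀ => bettiCohomology (Y q₀) 1) σ).symm (fun q₀ => BettiUniverse.pull (inj q₀) 1 ξ)) c)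
    rw [Equiv.piCongrLeft_symm_apply]
    change BettiUniverse.pull (f c) 1 ξ = BettiUniverse.pull (φ c).hom 1 (BettiUniverse.pull (inj (q c)) 1 ξ)
    rw [← pull_comp_apply, hφ c]
  rw [heq]
  exact hR₂.comp (R₁.bijective.comp hΘ)

/-! ## §2 The per-piece maps `f'^{x′} ≫ u` pull back bijectively -/

/-- **The Albanese criterion through the base-change comparison.**  For `Z` smooth projective over `ℂ` with a complex Albanese datum
`𝒥'` and `b₁(Z) ≤ 2 dim J(Z)` (the (R-ℂ) inequality), a point `x′ ∈ Z(ℂ)`, and a SURJECTIVE homomorphism `u : J(Z) → B` onto an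
abelian variety of dimension `≥ dim J(Z)` — i.e. `dim J(Z) ≤ dim B` (e.g. the comparison `J(E ⊗ ℂ) → J(E) ⊗ ℂ` under (R-bc)), the composite `f'^{x′} ≫ u` pulls back
bijectively on `H¹`: `f'^{x′}` by the Albanese criterion (`Jacobian.isIso_bettiCohomology_map_abelJacobi_of_finrank_le_of_dim`), `u` because
it is an isogeny (`AbelianVariety.isIsogeny_of_surjective_of_dim_eq`, `ComplexMultiplication.isogeny_bettiMap_bijective_holds`).
[cite: Liu2021, Lemma 2.4 (1)] [cite: Milne1986JacobianVarieties, §6 Prop. 6.1] -/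
theorem bijective_pull_abelJacobi_comp_of_surjective {d : ℕ} {Z : SchemeOver ℂ} (hZ : IsSmoothProjective d Z) (𝒥' : Jacobian Z)
    (hRC : Module.finrank ℚ (bettiCohomology Z 1) ≤ 2 * 𝒥'.J.dim) (x' : AlgPoints Z ℂ) {B : AbelianVariety ℂ}
    (u : 𝒥'.J ⟶ B) [Surjective (AbelianVariety.Hom.toSchemeHom u)] (hdim : 𝒥'.J.dim ≤ B.dim) :
    Function.Bijective (BettiUniverse.pull (𝒥'.abelJacobi x' ≫ u.hom.hom.hom) 1) := by
  haveI hiso := 𝒥'.isIso_bettiCohomology_map_abelJacobi_of_finrank_le_of_dim hZ x' hRC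
  have h1 : Function.Bijective (BettiUniverse.pull (𝒥'.abelJacobi x') 1) :=
    (asIso (bettiCohomology.map (𝒥'.abelJacobi x') 1)).toLinearEquiv.bijective
  have hdim' : 𝒥'.J.dim = B.dim := le_antisymm hdim (AbelianVariety.dim_le_of_surjective u)
  have h2 : Function.Bijective (BettiUniverse.pull u.hom.hom.hom 1) :=
    Literature.AlgebraicGeometry.ComplexMultiplication.isogeny_bettiMap_bijective_holds _ _ u
      (AbelianVariety.isIsogeny_of_surjective_of_dim_eq u hdim')
  have h12 : (BettiUniverse.pull (𝒥'.abelJacobi x' ≫ u.hom.hom.hom) 1 : bettiCohomology B.X 1 → bettiCohomology Z 1) =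
      BettiUniverse.pull (𝒥'.abelJacobi x') 1 ∘ BettiUniverse.pull u.hom.hom.hom 1 := by
    funext ξ; exact pull_comp_apply _ _ 1 ξ
  rw [h12]
  exact h1.comp h2

/-! ## §3 Lemma 2.4 (1) from the α-compatible fan read over `ℂ` -/

/-- **Lemma 2.4 (1) from an α-compatible Albanese fan** (the core of piece F6; see the module docstring for the data and the
proof). [cite: Liu2021, Lemma 2.4 (1) (FJcycle.tex l. 1210–1213) with proof (l. 1220–1228)] [cite: Grothendieck1962FGA6, Thm. 3.3 (iii)]
[cite: MumfordAV1970, §1 (3) and §19] [cite: Milne1986JacobianVarieties, §6 Prop. 6.1 and Prop. 6.4] -/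
theorem albanese_bettiOne_pullback_bijective_of_fan {k : Type} [Field k] [CharZero k] [Algebra k ℂ] {d : ℕ}
    (X : SchemeOver k) (a : Albanese X)
    {L : Type} [Field L] [Algebra k L] [Algebra L ℂ] (eX : (bcFunctor L ℂ).obj ((bcFunctor k L).obj X) ≅ (bcFunctor k ℂ).obj X)
    {C : Type} [Fintype C] (E : C → SchemeOver L) (e : ∀ c, E c ⟶ (bcFunctor k L).obj X)
    (hE : ∀ c, IsSmoothProjective d (E c)) (hcolL : IsColimit (Cofan.mk ((bcFunctor k L).obj X) e))
    (P : ∀ c, AlgPoints (E c) L) (𝒥 : ∀ c, Jacobian (E c))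
    (πℂ : ∀ c, a.Alb.baseChange ℂ ⟶ (𝒥 c).J.baseChange ℂ) (ιℂ : ∀ c, (𝒥 c).J.baseChange ℂ ⟶ a.Alb.baseChange ℂ)
    (hιπ : ∀ c, ιℂ c ≫ πℂ c = 𝟙 _) (hιπ' : ∀ c c', c ≠ c' → ιℂ c ≫ πℂ c' = 0) (htot : ∑ c, πℂ c ≫ ιℂ c = 𝟙 _)
    (lℂ : ∀ c, (bcFunctor L ℂ).obj (E c) ⊗ (bcFunctor L ℂ).obj (E c) ⟶ (bcFunctor k ℂ).obj a.nabla.N)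
    (hl : ∀ c, lℂ c ≫ (bcFunctor k ℂ).map a.nabla.incl =
      (((bcFunctor L ℂ).map (e c) ≫ eX.hom) ⊗ₘ
        ((bcFunctor L ℂ).map (e c) ≫ eX.hom)) ≫
        Functor.LaxMonoidal.μ (bcFunctor k ℂ) X X)
    (hlα : ∀ c, lℂ c ≫ (bcFunctor k ℂ).map a.α =
      Functor.LaxMonoidal.μ (bcFunctor L ℂ) (E c) (E c) ≫ (bcFunctor L ℂ).map (𝒥 c).diff ≫ (ιℂ c).hom.hom.hom)
    (hRbc : ∀ (c : C) (𝒥' : Jacobian ((bcFunctor L ℂ).obj (E c))), 𝒥'.J.dim ≤ (𝒥 c).J.dim)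
    (Ξ : Type) (Y : Ξ → SchemeOver ℂ) [∀ q, GeometricallyIrreducible (Y q).hom]
    (inj : ∀ q, Y q ⟶ (bcFunctor k ℂ).obj X) (hcol : IsColimit (Cofan.mk ((bcFunctor k ℂ).obj X) inj))
    {d' : ℕ} (hY : ∀ q, IsSmoothProjective d' (Y q))
    (hRC : ∀ (q : Ξ) (𝒥Y : Jacobian (Y q)), Module.finrank ℚ (bettiCohomology (Y q) 1) ≤ 2 * 𝒥Y.J.dim)
    (x : ∀ q, AlgPoints (Y q) ℂ) (ℓ : ∀ q, Y q ⊗ Y q ⟶ (bcFunctor k ℂ).obj a.nabla.N)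
    (hℓ : ∀ q, ℓ q ≫ (bcFunctor k ℂ).map a.nabla.incl = (inj q ⊗ₘ inj q) ≫ Functor.LaxMonoidal.μ (bcFunctor k ℂ) X X)
    (αx : (bcFunctor k ℂ).obj X ⟶ (a.Alb.baseChange ℂ).X)
    (hαx : ∀ q, inj q ≫ αx = lift (𝟙 (Y q)) (toSpecOver (Y q) ≫ x q) ≫ ℓ q ≫ (bcFunctor k ℂ).map a.α) :
    Function.Bijective (BettiUniverse.pull αx 1) := by
  classical
  -- §A matching of the pieces and joint bijectivity of the piece pull-backs
  obtain ⟨q, φ, hq, hφ⟩ := exists_bijective_iso_pieces (d := d) X eX E e hE hcolL Y inj hcol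
  have hf := bijective_pi_pull_pieces inj hcol q hq φ _ hφ
  -- §B the per-piece maps `g_c := f'^{x′_c} ≫ u_c`
  have hEℂ : ∀ c, IsSmoothProjective d ((bcFunctor L ℂ).obj (E c)) := fun c => (hE c).baseChange_obj ℂ
  have h𝒥' : ∀ c, Nonempty (Jacobian ((bcFunctor L ℂ).obj (E c))) := fun c =>
    nonempty_jacobian_of_isSmoothProjective_complex_of_dim _ (hEℂ c)
  let 𝒥' : ∀ c, Jacobian ((bcFunctor L ℂ).obj (E c)) := fun c => (h𝒥' c).some
  haveI : ∀ c, IsProper (E c).hom := fun c => (hE c).isProper_holds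
  haveI : ∀ c, GeometricallyIntegral (E c).hom := fun c => (hE c).geometricallyIntegral_holds
  have hu := fun c => Jacobian.exists_hom_baseChange_surjective ℂ (𝒥 c) (𝒥' c) (P c)
  choose u hu husurj using hu
  let x' : ∀ c, AlgPoints ((bcFunctor L ℂ).obj (E c)) ℂ := fun c => x (q c) ≫ (φ c).inv
  let g : ∀ c, (bcFunctor L ℂ).obj (E c) ⟶ ((𝒥 c).J.baseChange ℂ).X := fun c =>
    (𝒥' c).abelJacobi (x' c) ≫ (u c).hom.hom.hom
  have hg : ∀ c, Function.Bijective (BettiUniverse.pull (g c) 1) := by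
    intro c
    -- (R-ℂ) transported from `Y_{q c}` to `E_c ⊗ ℂ` along `φ c`
    obtain ⟨𝒥Y⟩ := nonempty_jacobian_of_isSmoothProjective_complex_of_dim _ (hY (q c))
    obtain ⟨jj⟩ := (𝒥' c).nonempty_iso_J_of_iso 𝒥Y (φ c)
    have hRC' : Module.finrank ℚ (bettiCohomology ((bcFunctor L ℂ).obj (E c)) 1) ≤ 2 * (𝒥' c).J.dim := by
      rw [(BettiUniverse.pullEquiv (φ c) 1).finrank_eq,
        ← AbelianVariety.dim_eq_of_isIsogeny (AbelianVariety.isIsogeny_hom_of_iso jj)]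
      exact hRC (q c) 𝒥Y
    haveI := husurj c
    have hdim : (𝒥' c).J.dim ≤ ((𝒥 c).J.baseChange ℂ).dim := by
      rw [AbelianVariety.dim_baseChange]; exact hRbc c (𝒥' c)
    exact bijective_pull_abelJacobi_comp_of_surjective (hEℂ c) (𝒥' c) hRC' (x' c) (u c) hdim
  -- §C the factorisation `f_c ≫ αx = g_c ≫ ιℂ_c`: `ℓ_{q c} ∘ (φ_c × φ_c)` and `lℂ_c` both lift `f_c × f_c` through the MONO `(∇X ↪ X × X)_ℂ`
  haveI hmono : Mono ((bcFunctor k ℂ).map a.nabla.incl) := by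
    haveI : IsOpenImmersion a.nabla.incl.left := a.nabla.isOpenImmersion_incl
    haveI : IsOpenImmersion ((bcFunctor k ℂ).map a.nabla.incl).left :=
      GaloisDescent.isOpenImmersion_bcFunctor_map_left ℂ a.nabla.incl
    exact Over.mono_of_mono_left _
  have hlift : ∀ c, ((φ c).hom ⊗ₘ (φ c).hom) ≫ ℓ (q c) = lℂ c := fun c => by
    rw [← cancel_mono ((bcFunctor k ℂ).map a.nabla.incl), Category.assoc, hℓ (q c), hl c, ← Category.assoc,
      MonoidalCategory.tensorHom_comp_tensorHom, hφ c]
  have hfac : ∀ c, ((bcFunctor L ℂ).map (e c) ≫ eX.hom) ≫ αx =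
      g c ≫ (ιℂ c).hom.hom.hom := fun c => by
    have hx' : (toSpecOver ((bcFunctor L ℂ).obj (E c)) ≫ x' c) ≫ (φ c).hom =
        (φ c).hom ≫ toSpecOver (Y (q c)) ≫ x (q c) := by
      change (toSpecOver _ ≫ x (q c) ≫ (φ c).inv) ≫ (φ c).hom = _
      rw [Category.assoc, Category.assoc, (φ c).inv_hom_id, Category.comp_id, ← Category.assoc, Jacobian.comp_toSpecOver]
    calc ((bcFunctor L ℂ).map (e c) ≫ eX.hom) ≫ αx
        = (φ c).hom ≫ inj (q c) ≫ αx := by rw [← Category.assoc, hφ c]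
      _ = (φ c).hom ≫ lift (𝟙 (Y (q c))) (toSpecOver (Y (q c)) ≫ x (q c)) ≫ ℓ (q c) ≫ (bcFunctor k ℂ).map a.α := by
          rw [hαx (q c)]
      _ = (lift (𝟙 _) (toSpecOver _ ≫ x' c) ≫ ((φ c).hom ⊗ₘ (φ c).hom)) ≫ ℓ (q c) ≫ (bcFunctor k ℂ).map a.α := by
          rw [lift_map, Category.id_comp, comp_lift_assoc, Category.comp_id, hx']
      _ = lift (𝟙 _) (toSpecOver _ ≫ x' c) ≫ lℂ c ≫ (bcFunctor k ℂ).map a.α := by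
          rw [← hlift c]; simp only [Category.assoc]
      _ = lift (𝟙 _) (toSpecOver _ ≫ x' c) ≫ Functor.LaxMonoidal.μ (bcFunctor L ℂ) (E c) (E c) ≫
            (bcFunctor L ℂ).map (𝒥 c).diff ≫ (ιℂ c).hom.hom.hom := by rw [hlα c]
      _ = (lift (𝟙 _) (toSpecOver _ ≫ x' c) ≫ (𝒥' c).diff) ≫ (u c).hom.hom.hom ≫ (ιℂ c).hom.hom.hom := by
          rw [Category.assoc, ← Category.assoc (𝒥' c).diff, hu c, Functor.Monoidal.μIso_hom]; simp only [Category.assoc]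
      _ = g c ≫ (ιℂ c).hom.hom.hom := by rw [← Category.assoc]; rfl
  -- §D conclusion
  exact bijective_pull_of_split_factorisation (fun c => (𝒥 c).J.baseChange ℂ) πℂ ιℂ hιπ hιπ' htot _ hf g hg αx hfac

/-! ## §4 Lemma 2.4 (1) at projective `X` — the consumer's `hLp` shape -/

/-- **Liu 2021 Lemma 2.4 (1) at PROJECTIVE `X`, unconditionally in the (G)-road's currency**: for `X / k` projective and smooth of
relative dimension `d` over a characteristic-zero field `k ⊆ ℂ` and a Liu Albanese datum `a` of `X` (Def. 2.3), the pull-back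
`αx^* : H¹(Alb_X ⊗_k ℂ; ℚ) → H¹(X ⊗_k ℂ; ℚ)` along any `αx` glued from `α_X` and complex points `x_q` of the connected components
`Y_q` of `X ⊗_k ℂ` (the consumer's data, stated verbatim as in `NotHJAlbStarBijectiveOfLemma24Proj`'s binder `hLp`) is BIJECTIVE,
granted the complex Albanese inequality (R-ℂ) `b₁(Y_q) ≤ 2 dim J(Y_q)` on the components.  PROOF: the α-compatible Albanese fan
over a finite Galois level read over `ℂ` (`Albanese.exists_isGalois_split_baseChange_complex_compat_abstract`, the (G)-road,
`eX` abstract) fed to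
`albanese_bettiOne_pullback_bijective_of_fan`, with (R-bc) supplied by `Jacobian.dim_le_dim_of_baseChange_complex`.
[cite: Liu2021, Lemma 2.4 (1) (FJcycle.tex l. 1210–1213) with proof (l. 1220–1228)] [cite: Grothendieck1962FGA6, Thm. 3.3 (iii)]
[cite: Milne1986JacobianVarieties, §6 Prop. 6.1] -/
theorem albanese_bettiOne_pullback_bijective_of_isProjectiveOver :
    ∀ {k : Type} [Field k] [CharZero k] [Algebra k ℂ] {d : ℕ} (X : SchemeOver k) [SmoothOfRelativeDimension d X.hom],
      IsProjectiveOver X → ∀ (a : Albanese X) (Ξ : Type) (Y : Ξ → SchemeOver ℂ) [∀ q, GeometricallyIrreducible (Y q).hom]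
      (inj : ∀ q, Y q ⟶ (bcFunctor k ℂ).obj X) (_ : IsColimit (Cofan.mk ((bcFunctor k ℂ).obj X) inj)) {d' : ℕ}
      (_ : ∀ q, IsSmoothProjective d' (Y q))
      (_ : ∀ (q : Ξ) (𝒥 : Jacobian (Y q)), Module.finrank ℚ (bettiCohomology (Y q) 1) ≤ 2 * 𝒥.J.dim)
      (x : ∀ q, AlgPoints (Y q) ℂ) (ℓ : ∀ q, Y q ⊗ Y q ⟶ (bcFunctor k ℂ).obj a.nabla.N)
      (_ : ∀ q, ℓ q ≫ (bcFunctor k ℂ).map a.nabla.incl = (inj q ⊗ₘ inj q) ≫ Functor.LaxMonoidal.μ (bcFunctor k ℂ) X X)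
      (αx : (bcFunctor k ℂ).obj X ⟶ (a.Alb.baseChange ℂ).X)
      (_ : ∀ q, inj q ≫ αx = lift (𝟙 (Y q)) (toSpecOver (Y q) ≫ x q) ≫ ℓ q ≫ (bcFunctor k ℂ).map a.α),
      Function.Bijective (BettiUniverse.pull αx 1) := by
  intro k _ _ _ d X _ hX a Ξ Y _ inj hcol d' hY hRC x ℓ hℓ αx hαx
  obtain ⟨L, _, _, _, _, _, -, eX, -, -, C, _, E, e, hE, ⟨hcolL⟩, P, 𝒥, πℂ, ιℂ, lℂ, hιπ, hιπ', htot, hl, hlα⟩ :=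
    Albanese.exists_isGalois_split_baseChange_complex_compat_abstract (d := d) X hX a
  exact albanese_bettiOne_pullback_bijective_of_fan X a eX E e hE hcolL P 𝒥 πℂ ιℂ hιπ hιπ' htot lℂ hl hlα
    (fun c 𝒥' => Jacobian.dim_le_dim_of_baseChange_complex (hE c) (𝒥 c) 𝒥') Ξ Y inj hcol hY hRC x ℓ hℓ αx hαx

end Literature.NumberTheory.Automorphic.Liu2021.AppendixC

end
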